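import Summits.CriticalPhenomena.Ising3DConformalLimit.Theorems.EnergyNotSigmaSquaredMoebiusLimitExistsPedigreeDefs
import Summits.CriticalPhenomena.Ising3DConformalLimit.Theorems.GapForcesFarMerging.Negative.IsingCertificate
import HarnessLib

/-! # Re-indexing invariance of single-variable asymptotic equicontinuity (stub svEquicont_transport of line only-interaction-breaks-moebius, crux MoebiusLimitExists, item stmt-CriticalPhenomena-1344, route EnergyNotSigmaSquared)

`SVEquicont u n K i` (single-variable asymptotic equicontinuity of the pinned critical zoom at the
moving index `i` on the set `K` of configurations) is invariant under re-indexing the points by an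
enumeration `e : Fin (a + b) ≃ Fin n`: the rescaled critical correlator is a symmetric function of
the points (the spin monomial is a commutative product) and the sup distance of configurations is
re-indexing invariant. The permutation invariance of the critical correlators is the tree's
`criticalCorr_comp_perm` (`Theorems/GapForcesFarMerging/Negative/IsingCertificate.lean`).
-/

noncomputable section

open Filter Topology Set Function Metric
open Literature.Probability.LatticeModels
open Summit.CriticalPhenomena.Ising3DConformalLimit.Theorems.GapForcesFarMerging.Negative

namespace Summit.CriticalPhenomena.Ising3DConformalLimit.MoebiusLimitExistsOnlyInteraction

/-- The rescaled pinned critical correlators at mesh `δ` are symmetric functions of the points.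
[folklore] -/
theorem rescaledCorrelator_comp_perm_tr {m : ℕ} (σ : Equiv.Perm (Fin m)) (δ : ℝ)
    (x : Fin m → EuclideanSpace ℝ (Fin 3)) :
    rescaledCorrelator (criticalCorr 3) rhoPin m δ (x ∘ ⇑σ) =
      rescaledCorrelator (criticalCorr 3) rhoPin m δ x := by
  simp only [rescaledCorrelator_apply, Function.comp_apply]
  exact congrArg _ (criticalCorr_comp_perm (fun i => latticeApprox δ (x i)) σ)

/-- Re-indexing the points by a permutation does not increase the sup distance of two
configurations. [folklore] -/
theorem dist_comp_perm_le_tr {m : ℕ} (σ : Equiv.Perm (Fin m))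
    (x x' : Fin m → EuclideanSpace ℝ (Fin 3)) :
    dist (x ∘ ⇑σ) (x' ∘ ⇑σ) ≤ dist x x' :=
  (dist_pi_le_iff dist_nonneg).2 fun j => dist_le_pi_dist x x' (σ j)

/-- **Re-indexing invariance of single-variable asymptotic equicontinuity.** If the pinned
`(a + b)`-point zoom is single-variable asymptotically equicontinuous at the index `castAdd b i₀`
on the re-indexed set `{x ∘ e | x ∈ K}` (for an enumeration `e : Fin (a + b) ≃ Fin n`), then the
pinned `n`-point zoom is single-variable asymptotically equicontinuous at the index
`e (castAdd b i₀)` on `K`: the rescaled correlator is a symmetric function of the points and the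
sup distance is re-indexing invariant. [folklore] -/
theorem svEquicont_transport :
    ∀ (u : ℕ → ℝ) (a b n : ℕ) (e : Fin (a + b) ≃ Fin n) (i₀ : Fin a)
      (K : Set (Fin n → EuclideanSpace ℝ (Fin 3))),
      SVEquicont u (a + b) ((fun x => x ∘ ⇑e) '' K) (Fin.castAdd b i₀) →
      SVEquicont u n K (e (Fin.castAdd b i₀)) := by
  intro u a b n e i₀ K h
  have hn : a + b = n := by simpa using Fintype.card_congr e
  subst hn
  intro ε hε
  obtain ⟨η, hη, hev⟩ := h ε hε
  refine ⟨η, hη, hev.mono fun k hk x hx x' hx' hdiff hdist => ?_⟩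
  have h1 := hk (x ∘ ⇑e) ⟨x, hx, rfl⟩ (x' ∘ ⇑e) ⟨x', hx', rfl⟩
    (fun j hj => hdiff (e j) fun h' => hj (e.injective h'))
    ((dist_comp_perm_le_tr e x x').trans_lt hdist)
  rwa [rescaledCorrelator_comp_perm_tr, rescaledCorrelator_comp_perm_tr] at h1

end Summit.CriticalPhenomena.Ising3DConformalLimit.MoebiusLimitExistsOnlyInteraction

end
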